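import Summits.QuantumFields.YangMills.Theses.ParabolicTrajectory

/-!
# `BalabanStepParabolic` — negative-side support I: the recorded one-loop coefficient `b₀` is a chart artefact

Support file for crux `stmt-QuantumFields-9684` (`ParabolicTrajectory.BalabanStepParabolic`), extracted from the
standing disprover's work file `Cruxes/BalabanStepParabolic/Disproof.lean` §R (cycle 2). Tree objects only.

* `rescale S l hl`: from ANY inhabitant `S : BalabanBanachStep G r M` and `l > 0`, the inhabitant obtained by
  rescaling the coupling coordinate `g ↦ l g` (same chart `E`, `φ' g y = l φ (g/l) y`, `Ψ' g y = Ψ (g/l) y`,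
  `b' = b/l²`, `b₀' = b₀/l²`, `κ' = κ l²`, `δ' = min l 1 · δ`, `C' = C/(min l 1)³`, `betaOf' = betaOf (·/l)`,
  `expect' (g, y) = expect (g/l, y)`); every one of the structure's fields is re-verified.
* `exists_b₀_eq`: if `BalabanBanachStep G r M` is inhabited, it is inhabited with ANY prescribed positive value of
  the field `b₀` ("the one-loop coefficient of `(G, r)`, recorded not computed").
* `rescale_κ_mul_b₀`: only the product `κ b₀` — the slope `β_{k+1} − β_k ≈ −2 κ b₀ log M` of the bare inverse
  coupling per block step — is invariant under the rescaling; NO field of the structure relates it to `(G, r)`.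

Consequence for the crux and the route: the informal clause "`b₀(G) = 11·C₂(G)/(48π²)`, uniform in `G`" of
`BalabanStepParabolic` is not captured by the typed statement, and an over- or under-tuned inhabitant (unphysical
`κ b₀`) satisfies the letter of the crux while being useless to `ContinuumLimitOnTrajectory` (whose tuned sequences
need `N₁(k) → θ > 0`). Repair options for the planner: pin `κ b₀` against `afCoefficient`, or add a non-triviality
clause for `expect` along the centre curve.
-/

namespace Summit.QuantumFields.YangMills.Theorems.BalabanStepParabolic.Negative

open scoped SchwartzMap
open MeasureTheory Filter Topology
open Literature.MathematicalPhysics.QuantumFieldTheory Literature.MathematicalPhysics.AQFT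
open Literature.MathematicalPhysics.QuantumLattice

noncomputable section

variable {G : Type} [Group G] [TopologicalSpace G] [IsTopologicalGroup G] [CompactSpace G]
  [MeasurableSpace G] [BorelSpace G] {r : LatticeRep G} {M : ℕ} (S : BalabanBanachStep G r M)

/-! ### §R  Rescaling the coupling coordinate: `b₀` alone is not pinned by the structure -/

section Rescale

variable (l : ℝ) (hl : 0 < l)

/-- `1 / l^a ≤ 1 / (min l 1)³` for `a ≤ 3`. [folklore] -/
theorem inv_pow_le (hl : 0 < l) {a : ℕ} (ha : a ≤ 3) : 1 / l ^ a ≤ 1 / (min l 1) ^ 3 := by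
  have hμ := (lt_min hl one_pos)
  have h1 : (min l 1) ^ 3 ≤ (min l 1) ^ a := pow_le_pow_of_le_one hμ.le ((min_le_right l 1)) ha
  have h2 : (min l 1) ^ a ≤ l ^ a := pow_le_pow_left₀ hμ.le ((min_le_left l 1)) a
  exact one_div_le_one_div_of_le (by positivity) (h1.trans h2)

/-- `1 ≤ 1 / (min l 1)³`. [folklore] -/
theorem one_le_inv_min_cube (hl : 0 < l) : (1 : ℝ) ≤ 1 / (min l 1) ^ 3 := by
  have h := inv_pow_le l hl (a := 0) (by norm_num)
  simpa using h

include hl in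
/-- Key estimate for the rescaled coupling remainder. [folklore] -/
theorem resc_φ_bound {g : ℝ} {y : S.E}
    (h : |S.φ (g / l) y - (g / l + S.b * (g / l) ^ 3)| ≤ S.C * ((g / l) ^ 4 + |g / l| ^ 3 * ‖y‖)) :
    |l * S.φ (g / l) y - (g + S.b / l ^ 2 * g ^ 3)| ≤
      S.C / (min l 1) ^ 3 * (g ^ 4 + |g| ^ 3 * ‖y‖) := by
  have hC := S.C_pos.le
  have hl' : l ≠ 0 := hl.ne'
  have e : l * S.φ (g / l) y - (g + S.b / l ^ 2 * g ^ 3) =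
      l * (S.φ (g / l) y - (g / l + S.b * (g / l) ^ 3)) := by
    field_simp
  rw [e, abs_mul, abs_of_pos hl]
  have h3 := inv_pow_le l hl (a := 3) le_rfl
  have h2 := inv_pow_le l hl (a := 2) (by norm_num)
  calc l * |S.φ (g / l) y - (g / l + S.b * (g / l) ^ 3)|
      ≤ l * (S.C * ((g / l) ^ 4 + |g / l| ^ 3 * ‖y‖)) := by gcongr
    _ = S.C * (g ^ 4 * (1 / l ^ 3) + |g| ^ 3 * ‖y‖ * (1 / l ^ 2)) := by
        rw [abs_div, abs_of_pos hl]
        field_simp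
    _ ≤ S.C * (g ^ 4 * (1 / (min l 1) ^ 3) + |g| ^ 3 * ‖y‖ * (1 / (min l 1) ^ 3)) := by
        gcongr
    _ = S.C / (min l 1) ^ 3 * (g ^ 4 + |g| ^ 3 * ‖y‖) := by
        field_simp

include hl in
/-- `|g| ≤ min l 1 · δ ⇒ |g / l| ≤ δ`. [folklore] -/
theorem abs_div_le {g : ℝ} (hg : |g| ≤ min l 1 * S.δ) : |g / l| ≤ S.δ := by
  rw [abs_div, abs_of_pos hl, div_le_iff₀ hl]
  calc |g| ≤ min l 1 * S.δ := hg
    _ ≤ l * S.δ := by gcongr; exacts [S.δ_pos.le, (min_le_left l 1)]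
    _ = S.δ * l := mul_comm _ _

include hl in
/-- **The rescaled step exists** (`g ↦ l·g`): same chart `E`, same `A, θ, θ', R, K`; `φ' g y = l φ(g/l) y`,
`Ψ' g y = Ψ (g/l) y`, `b' = b/l²`, `b₀' = b₀/l²`, `κ' = κ l²`, `δ' = min l 1 · δ`,
`C' = C / (min l 1)³`, `g₀' = l g₀`, `yW' = yW (·/l)`, `betaOf' = betaOf (·/l)`, `c' = c (·/l)`,
`expect' (g, y) = expect (g/l, y)`.  Every field of `BalabanBanachStep` is re-verified. [folklore] -/
theorem exists_rescale : ∃ S' : BalabanBanachStep G r M,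
    S'.b₀ = S.b₀ / l ^ 2 ∧ S'.κ = S.κ * l ^ 2 ∧ S'.E = S.E := by
  refine ⟨{
    E := S.E
    φ := fun g y => l * S.φ (g / l) y
    Ψ := fun g y => S.Ψ (g / l) y
    A := S.A
    b := S.b / l ^ 2
    θ := S.θ
    C := S.C / (min l 1) ^ 3
    δ := min l 1 * S.δ
    b_pos := div_pos S.b_pos (by positivity)
    θ_nonneg := S.θ_nonneg
    θ_lt_one := S.θ_lt_one
    C_pos := div_pos S.C_pos (pow_pos ((lt_min hl one_pos)) 3)
    δ_pos := mul_pos ((lt_min hl one_pos)) S.δ_pos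
    norm_A_le := S.norm_A_le
    remainder := fun g y hg hy => by
      have hμ1 := (min_le_right l 1)
      have hgl : |g / l| ≤ S.δ := abs_div_le S l hl hg
      have hyδ : ‖y‖ ≤ S.δ := hy.trans (by nlinarith [S.δ_pos])
      have h := S.remainder (g / l) y hgl hyδ
      refine ⟨resc_φ_bound S l hl h.1, ?_⟩
      have h2 := inv_pow_le l hl (a := 2) (by norm_num)
      have h0 := one_le_inv_min_cube l hl
      have hC := S.C_pos.le
      calc ‖S.Ψ (g / l) y - S.A y‖ ≤ S.C * ((g / l) ^ 2 + ‖y‖ ^ 2) := h.2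
        _ = S.C * (g ^ 2 * (1 / l ^ 2) + ‖y‖ ^ 2 * 1) := by field_simp
        _ ≤ S.C * (g ^ 2 * (1 / (min l 1) ^ 3) + ‖y‖ ^ 2 * (1 / (min l 1) ^ 3)) := by gcongr
        _ = S.C / (min l 1) ^ 3 * (g ^ 2 + ‖y‖ ^ 2) := by field_simp
    lipschitz_fibre := fun g y y' hg hy hy' => by
      have hμ1 := (min_le_right l 1)
      have hgl : |g / l| ≤ S.δ := abs_div_le S l hl hg
      have hyδ : ‖y‖ ≤ S.δ := hy.trans (by nlinarith [S.δ_pos])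
      have hy'δ : ‖y'‖ ≤ S.δ := hy'.trans (by nlinarith [S.δ_pos])
      have h := S.lipschitz_fibre (g / l) y y' hgl hyδ hy'δ
      have h2 := inv_pow_le l hl (a := 2) (by norm_num)
      have h1 := inv_pow_le l hl (a := 1) (by norm_num)
      have h0 := one_le_inv_min_cube l hl
      have hC := S.C_pos.le
      constructor
      · have e : l * S.φ (g / l) y - l * S.φ (g / l) y' = l * (S.φ (g / l) y - S.φ (g / l) y') := by
          ring
        rw [e, abs_mul, abs_of_pos hl]
        calc l * |S.φ (g / l) y - S.φ (g / l) y'| ≤ l * (S.C * |g / l| ^ 3 * ‖y - y'‖) := by gcongr; exact h.1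
          _ = S.C * (|g| ^ 3 * (1 / l ^ 2)) * ‖y - y'‖ := by
              rw [abs_div, abs_of_pos hl]; field_simp
          _ ≤ S.C * (|g| ^ 3 * (1 / (min l 1) ^ 3)) * ‖y - y'‖ := by gcongr
          _ = S.C / (min l 1) ^ 3 * |g| ^ 3 * ‖y - y'‖ := by field_simp
      · calc ‖S.Ψ (g / l) y - S.Ψ (g / l) y' - S.A (y - y')‖
            ≤ S.C * (|g / l| + ‖y‖ + ‖y'‖) * ‖y - y'‖ := h.2
          _ = S.C * (|g| * (1 / l ^ 1) + ‖y‖ * 1 + ‖y'‖ * 1) * ‖y - y'‖ := by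
              rw [abs_div, abs_of_pos hl]; field_simp
          _ ≤ S.C * (|g| * (1 / (min l 1) ^ 3) + ‖y‖ * (1 / (min l 1) ^ 3) + ‖y'‖ * (1 / (min l 1) ^ 3)) *
                ‖y - y'‖ := by gcongr
          _ = S.C / (min l 1) ^ 3 * (|g| + ‖y‖ + ‖y'‖) * ‖y - y'‖ := by field_simp
    lipschitz_base := fun g g' y hg hg' hy => by
      have hμ1 := (min_le_right l 1)
      have hgl : |g / l| ≤ S.δ := abs_div_le S l hl hg
      have hg'l : |g' / l| ≤ S.δ := abs_div_le S l hl hg'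
      have hyδ : ‖y‖ ≤ S.δ := hy.trans (by nlinarith [S.δ_pos])
      have h := S.lipschitz_base (g / l) (g' / l) y hgl hg'l hyδ
      have h3 := inv_pow_le l hl (a := 3) le_rfl
      have h2 := inv_pow_le l hl (a := 2) (by norm_num)
      have h1 := inv_pow_le l hl (a := 1) (by norm_num)
      have hC := S.C_pos.le
      have hmax : max |g / l| |g' / l| = max |g| |g'| / l := by
        rw [abs_div, abs_div, abs_of_pos hl, ← max_div_div_right hl.le]
      set m := max |g| |g'| with hm
      have hm0 : 0 ≤ m := (abs_nonneg g).trans (le_max_left _ _)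
      constructor
      · have e : l * S.φ (g / l) y - l * S.φ (g' / l) y - (g - g') - S.b / l ^ 2 * (g ^ 3 - g' ^ 3) =
            l * (S.φ (g / l) y - S.φ (g' / l) y - (g / l - g' / l) -
              S.b * ((g / l) ^ 3 - (g' / l) ^ 3)) := by
          field_simp
        rw [e, abs_mul, abs_of_pos hl]
        calc l * |S.φ (g / l) y - S.φ (g' / l) y - (g / l - g' / l) - S.b * ((g / l) ^ 3 - (g' / l) ^ 3)|
            ≤ l * (S.C * (max |g / l| |g' / l|) ^ 2 * (max |g / l| |g' / l| + ‖y‖) * |g / l - g' / l|) := by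
              gcongr; exact h.1
          _ = S.C * m ^ 2 * (m * (1 / l ^ 3) + ‖y‖ * (1 / l ^ 2)) * |g - g'| := by
              rw [hmax, show g / l - g' / l = (g - g') / l by ring, abs_div, abs_of_pos hl]
              field_simp
          _ ≤ S.C * m ^ 2 * (m * (1 / (min l 1) ^ 3) + ‖y‖ * (1 / (min l 1) ^ 3)) * |g - g'| := by gcongr
          _ = S.C / (min l 1) ^ 3 * m ^ 2 * (m + ‖y‖) * |g - g'| := by field_simp
      · calc ‖S.Ψ (g / l) y - S.Ψ (g' / l) y‖
            ≤ S.C * (|g / l| + |g' / l| + ‖y‖) * |g / l - g' / l| := h.2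
          _ = S.C * (|g| * (1 / l ^ 2) + |g'| * (1 / l ^ 2) + ‖y‖ * (1 / l ^ 1)) * |g - g'| := by
              rw [show g / l - g' / l = (g - g') / l by ring, abs_div, abs_div, abs_div, abs_of_pos hl]
              field_simp
          _ ≤ S.C * (|g| * (1 / (min l 1) ^ 3) + |g'| * (1 / (min l 1) ^ 3) + ‖y‖ * (1 / (min l 1) ^ 3)) *
                |g - g'| := by gcongr
          _ = S.C / (min l 1) ^ 3 * (|g| + |g'| + ‖y‖) * |g - g'| := by field_simp
    b₀ := S.b₀ / l ^ 2
    b_eq := by rw [S.b_eq]; ring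
    R := S.R
    δ_le_R := by
      calc min l 1 * S.δ ≤ 1 * S.δ := by gcongr; exacts [S.δ_pos.le, (min_le_right l 1)]
        _ = S.δ := one_mul _
        _ ≤ S.R := S.δ_le_R
    θ' := S.θ'
    θ'_nonneg := S.θ'_nonneg
    θ'_lt_one := S.θ'_lt_one
    contraction := fun g y y' hg hy hy' => S.contraction (g / l) y y' (abs_div_le S l hl hg) hy hy'
    remainder_basin := fun g y hg hy => by
      have hgl : |g / l| ≤ S.δ := abs_div_le S l hl hg
      exact resc_φ_bound S l hl (S.remainder_basin (g / l) y hgl hy)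
    yW := fun g => S.yW (g / l)
    g₀ := l * S.g₀
    g₀_pos := mul_pos hl S.g₀_pos
    continuousOn_yW := by
      refine S.continuousOn_yW.comp (continuousOn_id.div_const l) fun g hg => ?_
      exact ⟨div_nonneg hg.1 hl.le, (div_le_iff₀ hl).2 (by linarith [hg.2])⟩
    norm_yW_le := fun g hg => S.norm_yW_le (g / l) ⟨div_nonneg hg.1 hl.le, (div_le_iff₀ hl).2 (by linarith [hg.2])⟩
    betaOf := fun g => S.betaOf (g / l)
    strictAntiOn_betaOf := by
      intro g hg g' hg' hlt
      refine S.strictAntiOn_betaOf ⟨div_pos hg.1 hl, (div_le_iff₀ hl).2 (by linarith [hg.2])⟩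
        ⟨div_pos hg'.1 hl, (div_le_iff₀ hl).2 (by linarith [hg'.2])⟩ ?_
      exact div_lt_div_of_pos_right hlt hl
    continuousOn_betaOf := by
      refine S.continuousOn_betaOf.comp (continuousOn_id.div_const l) fun g hg => ?_
      exact ⟨div_pos hg.1 hl, (div_le_iff₀ hl).2 (by linarith [hg.2])⟩
    κ := S.κ * l ^ 2
    κ_pos := mul_pos S.κ_pos (by positivity)
    K := S.K
    betaOf_sub_le := fun g hg => by
      have h := S.betaOf_sub_le (g / l) ⟨div_pos hg.1 hl, (div_le_iff₀ hl).2 (by linarith [hg.2])⟩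
      have e : S.κ * l ^ 2 / g ^ 2 = S.κ / (g / l) ^ 2 := by
        have hg0 : g ≠ 0 := hg.1.ne'
        field_simp
      rw [e]; exact h
    c := fun g => S.c (g / l)
    c_curvature := fun g => S.c_curvature (g / l)
    expect := fun p => S.expect (p.1 / l, p.2)
    expect_step := fun g y hg hy S' n σ f => by
      have hgl : g / l ∈ Set.Icc 0 S.δ := by
        refine ⟨div_nonneg hg.1 hl.le, ?_⟩
        have : |g| ≤ min l 1 * S.δ := by rw [abs_of_nonneg hg.1]; exact hg.2
        have h := abs_div_le S l hl this
        exact (le_abs_self _).trans h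
      have h := S.expect_step (g / l) y hgl hy S' n σ f
      simp only
      rw [mul_div_cancel_left₀ _ hl.ne']
      exact h
    expect_wilson := fun g hg L n σ f => by
      simp only
      exact S.expect_wilson (g / l) ⟨div_pos hg.1 hl, (div_le_iff₀ hl).2 (by linarith [hg.2])⟩ L n σ f
    continuousOn_expect := fun S' n σ f hf => by
      have hmaps : Set.MapsTo (fun p : ℝ × S.E => (p.1 / l, p.2))
          (Set.Icc 0 (min l 1 * S.δ) ×ˢ Metric.closedBall (0 : S.E) S.R)
          (Set.Icc 0 S.δ ×ˢ Metric.closedBall (0 : S.E) S.R) := by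
        intro p hp
        refine Set.mk_mem_prod ⟨div_nonneg hp.1.1 hl.le, ?_⟩ hp.2
        have : |p.1| ≤ min l 1 * S.δ := by rw [abs_of_nonneg hp.1.1]; exact hp.1.2
        exact (le_abs_self _).trans (abs_div_le S l hl this)
      have hcont : Continuous (fun p : ℝ × S.E => (p.1 / l, p.2)) := by fun_prop
      exact (S.continuousOn_expect S' n σ f hf).comp hcont.continuousOn hmaps
  }, rfl, rfl, rfl⟩

end Rescale

include S in
/-- **`b₀` is unpinned.** If `BalabanBanachStep G r M` is inhabited at all, it is inhabited with ANY prescribed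
positive value `t` of the "one-loop coefficient" field `b₀`, on the same chart, with `κ b₀` unchanged (rescale the
coupling coordinate by `l = √(b₀/t)`). Hence the informal crux's clause "`b₀(G) = 11·C₂(G)/(48π²)`, uniform in `G`"
is NOT captured by the typed crux: `b₀` is meaningful only jointly with `κ`, and the product `κ b₀` — the physical
asymptotic-freedom slope — is constrained by no field. [folklore] -/
theorem exists_b₀_eq (t : ℝ) (ht : 0 < t) :
    ∃ S' : BalabanBanachStep G r M, S'.b₀ = t ∧ S'.κ * S'.b₀ = S.κ * S.b₀ ∧ S'.E = S.E := by
  have hb := S.b₀_pos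
  obtain ⟨S', h1, h2, h3⟩ := exists_rescale S (Real.sqrt (S.b₀ / t)) (Real.sqrt_pos.2 (div_pos hb ht))
  refine ⟨S', ?_, ?_, h3⟩
  · rw [h1, Real.sq_sqrt (div_pos hb ht).le]
    field_simp
  · rw [h1, h2, Real.sq_sqrt (div_pos hb ht).le]
    field_simp

end

end Summit.QuantumFields.YangMills.Theorems.BalabanStepParabolic.Negative
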